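import Summits.CriticalPhenomena.CardyFormulaZ2.Theorems.CardyUSTContinuationKirchhoffExtremalLengthTraversal

/-!
# Kirchhoff's theorem for the UST limit of the jointly wired FK model, III: existence of
# traversed edges and counting

Support file for `KirchhoffExtremalLength` (route CardyUSTContinuation of `CardyFormulaZ2`, item
stmt-CriticalPhenomena-11234); part of the proof of Kirchhoff's theorem for the uniform-spanning-tree
limit of the jointly wired FK model (`coeff_div_coeff_eq_toReal_effectiveConductance`, part V).
This part: at a free vertex a traversed edge leaves iff one enters, exactly one traversed edge leaves
`B₁` (`exists_traversed_in_of_out`, `exists_traversed_out_of_in`, `traversed_source_unique`,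
`exists_traversed_source`), and the resulting cardinality statements
(`card_traversed_out_eq_card_traversed_in`, `sum_card_traversed_out_eq_one`).
-/

noncomputable section

namespace Summit.CriticalPhenomena.CardyFormulaZ2.Theorems

namespace KirchhoffSlope

open Finset SimpleGraph
open Literature.Probability.LatticeModels Literature.Probability.Percolation

variable {V : Type*} [DecidableEq V]

/-! ### §6. Traversed edges: existence (flow conservation at a free vertex, source strength) -/

section Existence

variable [Fintype V] {G : SimpleGraph V} [DecidableRel G.Adj] {W : Set V} {m : ℕ}
  {B₁ B₂ : Set V} {ω' : Finset (Sym2 V)}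

/-- **A traversed edge leaving a free vertex is preceded by one entering it.** If `z ∉ W` and
`zw` is traversed from `z` to `w` (cf. `traversed_out_unique`), then the first edge `zw'` of an
open path from `z` to its root in `ω' ∖ zw` is traversed from `w'` to `z`. [folklore] -/
theorem exists_traversed_in_of_out
    (hm : ∀ ω ⊆ G.edgeFinset, m ≤ #ω + 2 * clusterCount (↑ω : BondConfig V) W)
    (hω' : ω' ⊆ G.edgeFinset) (hE' : #ω' + 2 * clusterCount (↑ω' : BondConfig V) W = m + 1)
    (hB₁ : B₁ ⊆ W) (hB₂ : B₂ ⊆ W) (hW : W ⊆ B₁ ∪ B₂) (hdisj : Disjoint B₁ B₂)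
    {z w : V} (hz : z ∉ W) (h : s(z, w) ∈ ω')
    (hE₀ : #(ω'.erase s(z, w)) + 2 * clusterCount (↑(ω'.erase s(z, w)) : BondConfig V) W = m)
    (hc : ∃ a ∈ B₁, (openGraph (↑(ω'.erase s(z, w)) : BondConfig V)).Reachable z a)
    (hn : ¬ ∃ a ∈ B₁, (openGraph (↑(ω'.erase s(z, w)) : BondConfig V)).Reachable w a) :
    ∃ w', s(w', z) ∈ ω' ∧
      #(ω'.erase s(w', z)) + 2 * clusterCount (↑(ω'.erase s(w', z)) : BondConfig V) W = m ∧
      (∃ a ∈ B₁, (openGraph (↑(ω'.erase s(w', z)) : BondConfig V)).Reachable w' a) ∧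
      ¬ ∃ a ∈ B₁, (openGraph (↑(ω'.erase s(w', z)) : BondConfig V)).Reachable z a := by
  classical
  set ω₀ := ω'.erase s(z, w) with hω₀
  have hsub₀ : ω₀ ⊆ G.edgeFinset := (Finset.erase_subset _ _).trans hω'
  have hzw : G.Adj z w := mem_edgeFinset.1 (hω' h)
  obtain ⟨a, ha, hza⟩ := hc
  obtain ⟨b, hb, hwb⟩ := exists_root_mem_of_not hm hB₁ hW hsub₀ hE₀ ha hza hzw hn
  have hab : a ≠ b := hdisj.ne_of_mem ha hb
  have hzna : z ≠ a := fun h' => hz (h' ▸ hB₁ ha)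
  obtain ⟨p, hp⟩ : ∃ p : (openGraph (↑ω₀ : BondConfig V)).Walk z a, p.IsPath :=
    ⟨hza.some.toPath, hza.some.toPath.2⟩
  cases p with
  | nil => exact (hzna rfl).elim
  | @cons _ w' _ hadj p' =>
    obtain ⟨hmem', hne'⟩ := (openGraph_adj _ _ _).1 hadj
    rw [SimpleGraph.Walk.cons_isPath_iff] at hp
    have hmem'ω' : s(z, w') ∈ ω' := Finset.mem_of_mem_erase hmem'
    have hww' : w' ≠ w := fun h' => (Finset.mem_erase.1 hmem').1 (by rw [h'])
    set ω₃ := ω'.erase s(w', z) with hω₃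
    have hω₃' : ω₃ = ω'.erase s(z, w') := by rw [hω₃, Sym2.eq_swap]
    have hsub₃ : ω₃ ⊆ G.edgeFinset := (Finset.erase_subset _ _).trans hω'
    have hw'a : (openGraph (↑(ω₀.erase s(z, w')) : BondConfig V)).Reachable w' a :=
      reachable_erase_of_notMem_support p' hp.2
    have mono₀₃ : openGraph (↑(ω₀.erase s(z, w')) : BondConfig V) ≤ openGraph (↑ω₃ : BondConfig V) := by
      rw [hω₃']
      exact openGraph_mono (Finset.coe_subset.2 (Finset.erase_subset_erase _ (Finset.erase_subset _ _)))
    have mono₀ : openGraph (↑(ω₀.erase s(z, w')) : BondConfig V) ≤ openGraph (↑ω₀ : BondConfig V) :=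
      openGraph_mono (Finset.coe_subset.2 (Finset.erase_subset _ _))
    have hw'a₃ : (openGraph (↑ω₃ : BondConfig V)).Reachable w' a := hw'a.mono mono₀₃
    have hmem_zw₃ : s(z, w) ∈ ω₃ := by
      rw [hω₃']
      exact Finset.mem_erase.2 ⟨sym2_ne_of_ne hww' hne', h⟩
    have adj_zw₃ : (openGraph (↑ω₃ : BondConfig V)).Adj z w := (openGraph_adj _ _ _).2 ⟨hmem_zw₃, hzw.ne⟩
    -- `z` reaches `b` in `ω₃`
    have hzb₃ : (openGraph (↑ω₃ : BondConfig V)).Reachable z b := by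
      rcases reachable_erase_trichotomy (ω := ω₀) (u := z) (v := w') hwb.some with h3 | ⟨-, h3⟩ | ⟨-, h3⟩
      · exact adj_zw₃.reachable.trans (h3.mono mono₀₃)
      · exact (not_reachable_of_minimal hm hsub₀ hE₀ (hB₁ ha) (hB₂ hb) hab
          ((hw'a.symm.trans h3).mono mono₀)).elim
      · exact h3.mono mono₀₃
    -- hence `ω₃` is a minimiser
    have hH : (openGraph (↑ω₃ : BondConfig V) ⊔ wired W).Reachable w' z :=
      ((hw'a₃.mono le_sup_left).trans ((reachable_wired (hB₁ ha) (hB₂ hb)).mono le_sup_right)).trans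
        (hzb₃.symm.mono le_sup_left)
    have hk : clusterCount (↑ω₃ : BondConfig V) W = clusterCount (↑ω' : BondConfig V) W :=
      clusterCount_erase_eq_of_reachable hH
    have hmem₃ : s(w', z) ∈ ω' := by rw [Sym2.eq_swap]; exact hmem'ω'
    have hE₃ : #ω₃ + 2 * clusterCount (↑ω₃ : BondConfig V) W = m := by
      rw [hk, hω₃, Finset.card_erase_of_mem hmem₃]
      have hpos : 0 < #ω' := Finset.card_pos.2 ⟨_, hmem₃⟩
      omega
    refine ⟨w', hmem₃, hE₃, ⟨a, ha, hw'a₃⟩, ?_⟩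
    rintro ⟨a', ha', hza'⟩
    exact not_reachable_of_minimal hm hsub₃ hE₃ (hB₁ ha') (hB₂ hb) (hdisj.ne_of_mem ha' hb)
      (hza'.symm.trans hzb₃)

/-- **A traversed edge entering a free vertex is followed by one leaving it.** If `z ∉ W` and
`wz` is traversed from `w` to `z`, then the first edge `zw'` of an open path from `z` to its root
in `ω' ∖ wz` is traversed from `z` to `w'`. [folklore] -/
theorem exists_traversed_out_of_in
    (hm : ∀ ω ⊆ G.edgeFinset, m ≤ #ω + 2 * clusterCount (↑ω : BondConfig V) W)
    (hω' : ω' ⊆ G.edgeFinset) (hE' : #ω' + 2 * clusterCount (↑ω' : BondConfig V) W = m + 1)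
    (hB₁ : B₁ ⊆ W) (hB₂ : B₂ ⊆ W) (hW : W ⊆ B₁ ∪ B₂) (hdisj : Disjoint B₁ B₂)
    {z w : V} (hz : z ∉ W) (h : s(w, z) ∈ ω')
    (hE₀ : #(ω'.erase s(w, z)) + 2 * clusterCount (↑(ω'.erase s(w, z)) : BondConfig V) W = m)
    (hc : ∃ a ∈ B₁, (openGraph (↑(ω'.erase s(w, z)) : BondConfig V)).Reachable w a)
    (hn : ¬ ∃ a ∈ B₁, (openGraph (↑(ω'.erase s(w, z)) : BondConfig V)).Reachable z a) :
    ∃ w', s(z, w') ∈ ω' ∧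
      #(ω'.erase s(z, w')) + 2 * clusterCount (↑(ω'.erase s(z, w')) : BondConfig V) W = m ∧
      (∃ a ∈ B₁, (openGraph (↑(ω'.erase s(z, w')) : BondConfig V)).Reachable z a) ∧
      ¬ ∃ a ∈ B₁, (openGraph (↑(ω'.erase s(z, w')) : BondConfig V)).Reachable w' a := by
  classical
  set ω₀ := ω'.erase s(w, z) with hω₀
  have hsub₀ : ω₀ ⊆ G.edgeFinset := (Finset.erase_subset _ _).trans hω'
  have hwz : G.Adj w z := mem_edgeFinset.1 (hω' h)
  obtain ⟨a, ha, hwa⟩ := hc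
  obtain ⟨b, hb, hzb⟩ := exists_root_mem_of_not hm hB₁ hW hsub₀ hE₀ ha hwa hwz hn
  have hab : a ≠ b := hdisj.ne_of_mem ha hb
  have hznb : z ≠ b := fun h' => hz (h' ▸ hB₂ hb)
  obtain ⟨p, hp⟩ : ∃ p : (openGraph (↑ω₀ : BondConfig V)).Walk z b, p.IsPath :=
    ⟨hzb.some.toPath, hzb.some.toPath.2⟩
  cases p with
  | nil => exact (hznb rfl).elim
  | @cons _ w' _ hadj p' =>
    obtain ⟨hmem', hne'⟩ := (openGraph_adj _ _ _).1 hadj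
    rw [SimpleGraph.Walk.cons_isPath_iff] at hp
    have hmem'ω' : s(z, w') ∈ ω' := Finset.mem_of_mem_erase hmem'
    have hww' : w' ≠ w := fun h' => (Finset.mem_erase.1 hmem').1 (by rw [h', Sym2.eq_swap])
    set ω₃ := ω'.erase s(z, w') with hω₃
    have hsub₃ : ω₃ ⊆ G.edgeFinset := (Finset.erase_subset _ _).trans hω'
    have hw'b : (openGraph (↑(ω₀.erase s(z, w')) : BondConfig V)).Reachable w' b :=
      reachable_erase_of_notMem_support p' hp.2
    have mono₀₃ : openGraph (↑(ω₀.erase s(z, w')) : BondConfig V) ≤ openGraph (↑ω₃ : BondConfig V) :=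
      openGraph_mono (Finset.coe_subset.2 (Finset.erase_subset_erase _ (Finset.erase_subset _ _)))
    have mono₀ : openGraph (↑(ω₀.erase s(z, w')) : BondConfig V) ≤ openGraph (↑ω₀ : BondConfig V) :=
      openGraph_mono (Finset.coe_subset.2 (Finset.erase_subset _ _))
    have hw'b₃ : (openGraph (↑ω₃ : BondConfig V)).Reachable w' b := hw'b.mono mono₀₃
    have hmem_wz₃ : s(w, z) ∈ ω₃ := by
      refine Finset.mem_erase.2 ⟨fun heq => ?_, h⟩
      rw [Sym2.eq_iff] at heq
      rcases heq with ⟨h1, -⟩ | ⟨h1, -⟩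
      · exact hwz.ne h1
      · exact hww' h1.symm
    have adj_wz₃ : (openGraph (↑ω₃ : BondConfig V)).Adj w z := (openGraph_adj _ _ _).2 ⟨hmem_wz₃, hwz.ne⟩
    -- `z` reaches `a` in `ω₃`
    have hza₃ : (openGraph (↑ω₃ : BondConfig V)).Reachable z a := by
      rcases reachable_erase_trichotomy (ω := ω₀) (u := z) (v := w') hwa.some with h3 | ⟨-, h3⟩ | ⟨-, h3⟩
      · exact adj_wz₃.symm.reachable.trans (h3.mono mono₀₃)
      · exact (not_reachable_of_minimal hm hsub₀ hE₀ (hB₁ ha) (hB₂ hb) hab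
          ((h3.symm.trans hw'b).mono mono₀)).elim
      · exact h3.mono mono₀₃
    have hH : (openGraph (↑ω₃ : BondConfig V) ⊔ wired W).Reachable z w' :=
      ((hza₃.mono le_sup_left).trans ((reachable_wired (hB₁ ha) (hB₂ hb)).mono le_sup_right)).trans
        (hw'b₃.symm.mono le_sup_left)
    have hk : clusterCount (↑ω₃ : BondConfig V) W = clusterCount (↑ω' : BondConfig V) W :=
      clusterCount_erase_eq_of_reachable hH
    have hE₃ : #ω₃ + 2 * clusterCount (↑ω₃ : BondConfig V) W = m := by
      rw [hk, hω₃, Finset.card_erase_of_mem hmem'ω']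
      have hpos : 0 < #ω' := Finset.card_pos.2 ⟨_, hmem'ω'⟩
      omega
    refine ⟨w', hmem'ω', hE₃, ⟨a, ha, hza₃⟩, ?_⟩
    rintro ⟨a', ha', hw'a'⟩
    exact not_reachable_of_minimal hm hsub₃ hE₃ (hB₁ ha') (hB₂ hb) (hdisj.ne_of_mem ha' hb)
      (hw'a'.symm.trans hw'b₃)

/-- **Only one edge is traversed out of `B₁`.** If `a₁w₁` and `a₂w₂` (with `a₁, a₂ ∈ B₁`) are
both traversed, then `a₁ = a₂`. [folklore] -/
theorem traversed_source_unique
    (hm : ∀ ω ⊆ G.edgeFinset, m ≤ #ω + 2 * clusterCount (↑ω : BondConfig V) W)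
    (hω' : ω' ⊆ G.edgeFinset) (hB₁ : B₁ ⊆ W) (hB₂ : B₂ ⊆ W) (hW : W ⊆ B₁ ∪ B₂) (hdisj : Disjoint B₁ B₂)
    {a₁ a₂ w₁ w₂ : V} (ha₁ : a₁ ∈ B₁) (ha₂ : a₂ ∈ B₁)
    (h₁ : s(a₁, w₁) ∈ ω')
    (hE₁ : #(ω'.erase s(a₁, w₁)) + 2 * clusterCount (↑(ω'.erase s(a₁, w₁)) : BondConfig V) W = m)
    (hn₁ : ¬ ∃ a ∈ B₁, (openGraph (↑(ω'.erase s(a₁, w₁)) : BondConfig V)).Reachable w₁ a)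
    (h₂ : s(a₂, w₂) ∈ ω')
    (hE₂ : #(ω'.erase s(a₂, w₂)) + 2 * clusterCount (↑(ω'.erase s(a₂, w₂)) : BondConfig V) W = m)
    (hn₂ : ¬ ∃ a ∈ B₁, (openGraph (↑(ω'.erase s(a₂, w₂)) : BondConfig V)).Reachable w₂ a) :
    a₁ = a₂ := by
  classical
  by_contra hne
  set ω₁ := ω'.erase s(a₁, w₁) with hω₁
  set ω₂ := ω'.erase s(a₂, w₂) with hω₂
  have hsub₁ : ω₁ ⊆ G.edgeFinset := (Finset.erase_subset _ _).trans hω'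
  have hsub₂ : ω₂ ⊆ G.edgeFinset := (Finset.erase_subset _ _).trans hω'
  have hadj₁ : G.Adj a₁ w₁ := mem_edgeFinset.1 (hω' h₁)
  have hadj₂ : G.Adj a₂ w₂ := mem_edgeFinset.1 (hω' h₂)
  obtain ⟨b₁, hb₁, hw₁b₁⟩ := exists_root_mem_of_not hm hB₁ hW hsub₁ hE₁ ha₁ (Reachable.refl _) hadj₁ hn₁
  obtain ⟨b₂, hb₂, hw₂b₂⟩ := exists_root_mem_of_not hm hB₁ hW hsub₂ hE₂ ha₂ (Reachable.refl _) hadj₂ hn₂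
  have hw₁B₁ : w₁ ∉ B₁ := fun h' => hn₁ ⟨w₁, h', Reachable.refl _⟩
  have hmem₂₁ : s(a₂, w₂) ∈ ω₁ := by
    refine Finset.mem_erase.2 ⟨fun heq => ?_, h₂⟩
    rw [Sym2.eq_iff] at heq
    rcases heq with ⟨h1, -⟩ | ⟨h1, -⟩
    · exact hne h1.symm
    · exact hw₁B₁ (h1 ▸ ha₂)
  have adj₂₁ : (openGraph (↑ω₁ : BondConfig V)).Adj a₂ w₂ := (openGraph_adj _ _ _).2 ⟨hmem₂₁, hadj₂.ne⟩
  have hcomm : ω₂.erase s(a₁, w₁) = ω₁.erase s(a₂, w₂) := Finset.erase_right_comm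
  have mono₁₂ : openGraph (↑(ω₁.erase s(a₂, w₂)) : BondConfig V) ≤ openGraph (↑ω₁ : BondConfig V) :=
    openGraph_mono (Finset.coe_subset.2 (Finset.erase_subset _ _))
  have mono₂ : openGraph (↑(ω₂.erase s(a₁, w₁)) : BondConfig V) ≤ openGraph (↑ω₂ : BondConfig V) :=
    openGraph_mono (Finset.coe_subset.2 (Finset.erase_subset _ _))
  rcases reachable_erase_trichotomy (ω := ω₂) (u := a₁) (v := w₁) hw₂b₂.some with h3 | ⟨h3, -⟩ | ⟨-, h3⟩
  · rw [hcomm] at h3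
    exact not_reachable_of_minimal hm hsub₁ hE₁ (hB₁ ha₂) (hB₂ hb₂) (hdisj.ne_of_mem ha₂ hb₂)
      (adj₂₁.reachable.trans (h3.mono mono₁₂))
  · exact hn₂ ⟨a₁, ha₁, h3.mono mono₂⟩
  · rw [hcomm] at h3
    exact not_reachable_of_minimal hm hsub₁ hE₁ (hB₁ ha₁) (hB₂ hb₂) (hdisj.ne_of_mem ha₁ hb₂)
      (h3.mono mono₁₂)

/-- **Some edge is traversed out of `B₁`**: the first edge of an open crossing. [folklore] -/
theorem exists_traversed_source
    (hB₁ : B₁ ⊆ W) (hB₂ : B₂ ⊆ W) (hdisj : Disjoint B₁ B₂)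
    (hm : ∀ ω ⊆ G.edgeFinset, m ≤ #ω + 2 * clusterCount (↑ω : BondConfig V) W)
    (hω' : ω' ⊆ G.edgeFinset) (hE' : #ω' + 2 * clusterCount (↑ω' : BondConfig V) W = m + 1)
    (hcross : ∃ a ∈ B₁, ∃ b ∈ B₂, (openGraph (↑ω' : BondConfig V)).Reachable a b) :
    ∃ a ∈ B₁, ∃ w, s(a, w) ∈ ω' ∧
      #(ω'.erase s(a, w)) + 2 * clusterCount (↑(ω'.erase s(a, w)) : BondConfig V) W = m ∧
      ¬ ∃ a' ∈ B₁, (openGraph (↑(ω'.erase s(a, w)) : BondConfig V)).Reachable w a' := by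
  classical
  obtain ⟨a, ha, b, hb, hab⟩ := hcross
  have hne : a ≠ b := hdisj.ne_of_mem ha hb
  obtain ⟨p, hp⟩ : ∃ p : (openGraph (↑ω' : BondConfig V)).Walk a b, p.IsPath :=
    ⟨hab.some.toPath, hab.some.toPath.2⟩
  cases p with
  | nil => exact (hne rfl).elim
  | @cons _ w _ hadj p' =>
    obtain ⟨hmem, hne'⟩ := (openGraph_adj _ _ _).1 hadj
    rw [SimpleGraph.Walk.cons_isPath_iff] at hp
    set ω₃ := ω'.erase s(a, w) with hω₃
    have hsub₃ : ω₃ ⊆ G.edgeFinset := (Finset.erase_subset _ _).trans hω'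
    have hwb : (openGraph (↑ω₃ : BondConfig V)).Reachable w b := reachable_erase_of_notMem_support p' hp.2
    have hH : (openGraph (↑ω₃ : BondConfig V) ⊔ wired W).Reachable a w :=
      ((reachable_wired (hB₁ ha) (hB₂ hb)).mono le_sup_right).trans (hwb.symm.mono le_sup_left)
    have hk : clusterCount (↑ω₃ : BondConfig V) W = clusterCount (↑ω' : BondConfig V) W :=
      clusterCount_erase_eq_of_reachable hH
    have hE₃ : #ω₃ + 2 * clusterCount (↑ω₃ : BondConfig V) W = m := by
      rw [hk, hω₃, Finset.card_erase_of_mem hmem]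
      have hpos : 0 < #ω' := Finset.card_pos.2 ⟨_, hmem⟩
      omega
    refine ⟨a, ha, w, hmem, hE₃, ?_⟩
    rintro ⟨a', ha', hwa'⟩
    exact not_reachable_of_minimal hm hsub₃ hE₃ (hB₁ ha') (hB₂ hb) (hdisj.ne_of_mem ha' hb)
      (hwa'.symm.trans hwb)

end Existence


/-! ### §7. Counting traversed edges at a vertex -/

section Counting

variable [Fintype V] {G : SimpleGraph V} [DecidableRel G.Adj] {W : Set V} {m : ℕ}
  {B₁ B₂ : Set V} {ω' : Finset (Sym2 V)}

open scoped Classical in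
/-- **Flow conservation at a free vertex**: in a crossing configuration of exponent `m + 1`, a
vertex `z ∉ W` has as many traversed edges leaving it as entering it (both numbers are `0` or
both are `1`). [folklore] -/
theorem card_traversed_out_eq_card_traversed_in
    (hm : ∀ ω ⊆ G.edgeFinset, m ≤ #ω + 2 * clusterCount (↑ω : BondConfig V) W)
    (hω' : ω' ⊆ G.edgeFinset) (hE' : #ω' + 2 * clusterCount (↑ω' : BondConfig V) W = m + 1)
    (hB₁ : B₁ ⊆ W) (hB₂ : B₂ ⊆ W) (hW : W ⊆ B₁ ∪ B₂) (hdisj : Disjoint B₁ B₂)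
    (hcross : ∃ a ∈ B₁, ∃ b ∈ B₂, (openGraph (↑ω' : BondConfig V)).Reachable a b)
    {z : V} (hz : z ∉ W) :
    #(Finset.univ.filter fun w => s(z, w) ∈ ω' ∧
        #(ω'.erase s(z, w)) + 2 * clusterCount (↑(ω'.erase s(z, w)) : BondConfig V) W = m ∧
        (∃ a ∈ B₁, (openGraph (↑(ω'.erase s(z, w)) : BondConfig V)).Reachable z a) ∧
        ¬ ∃ a ∈ B₁, (openGraph (↑(ω'.erase s(z, w)) : BondConfig V)).Reachable w a) =
    #(Finset.univ.filter fun w => s(w, z) ∈ ω' ∧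
        #(ω'.erase s(w, z)) + 2 * clusterCount (↑(ω'.erase s(w, z)) : BondConfig V) W = m ∧
        (∃ a ∈ B₁, (openGraph (↑(ω'.erase s(w, z)) : BondConfig V)).Reachable w a) ∧
        ¬ ∃ a ∈ B₁, (openGraph (↑(ω'.erase s(w, z)) : BondConfig V)).Reachable z a) := by
  set OUT := Finset.univ.filter fun w => s(z, w) ∈ ω' ∧
        #(ω'.erase s(z, w)) + 2 * clusterCount (↑(ω'.erase s(z, w)) : BondConfig V) W = m ∧
        (∃ a ∈ B₁, (openGraph (↑(ω'.erase s(z, w)) : BondConfig V)).Reachable z a) ∧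
        ¬ ∃ a ∈ B₁, (openGraph (↑(ω'.erase s(z, w)) : BondConfig V)).Reachable w a with hOUT
  set IN := Finset.univ.filter fun w => s(w, z) ∈ ω' ∧
        #(ω'.erase s(w, z)) + 2 * clusterCount (↑(ω'.erase s(w, z)) : BondConfig V) W = m ∧
        (∃ a ∈ B₁, (openGraph (↑(ω'.erase s(w, z)) : BondConfig V)).Reachable w a) ∧
        ¬ ∃ a ∈ B₁, (openGraph (↑(ω'.erase s(w, z)) : BondConfig V)).Reachable z a with hIN
  have hOUT1 : #OUT ≤ 1 := by
    refine Finset.card_le_one.2 fun w₁ hw₁ w₂ hw₂ => ?_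
    rw [hOUT, Finset.mem_filter] at hw₁ hw₂
    exact traversed_out_unique hm hω' hE' hB₁ hB₂ hW hdisj hcross hw₁.2.1 hw₁.2.2.1 hw₁.2.2.2.1
      hw₁.2.2.2.2 hw₂.2.1 hw₂.2.2.1 hw₂.2.2.2.1 hw₂.2.2.2.2
  have hIN1 : #IN ≤ 1 := by
    refine Finset.card_le_one.2 fun w₁ hw₁ w₂ hw₂ => ?_
    rw [hIN, Finset.mem_filter] at hw₁ hw₂
    exact traversed_in_unique hm hω' hE' hB₁ hB₂ hW hdisj hcross hw₁.2.1 hw₁.2.2.1 hw₁.2.2.2.1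
      hw₁.2.2.2.2 hw₂.2.1 hw₂.2.2.2.1
  have hOI : OUT.Nonempty → IN.Nonempty := by
    rintro ⟨w, hw⟩
    rw [hOUT, Finset.mem_filter] at hw
    obtain ⟨w', h1, h2, h3, h4⟩ := exists_traversed_in_of_out hm hω' hE' hB₁ hB₂ hW hdisj hz hw.2.1
      hw.2.2.1 hw.2.2.2.1 hw.2.2.2.2
    exact ⟨w', by rw [hIN, Finset.mem_filter]; exact ⟨Finset.mem_univ _, h1, h2, h3, h4⟩⟩
  have hIO : IN.Nonempty → OUT.Nonempty := by
    rintro ⟨w, hw⟩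
    rw [hIN, Finset.mem_filter] at hw
    obtain ⟨w', h1, h2, h3, h4⟩ := exists_traversed_out_of_in hm hω' hE' hB₁ hB₂ hW hdisj hz hw.2.1
      hw.2.2.1 hw.2.2.2.1 hw.2.2.2.2
    exact ⟨w', by rw [hOUT, Finset.mem_filter]; exact ⟨Finset.mem_univ _, h1, h2, h3, h4⟩⟩
  rcases Nat.eq_zero_or_pos #OUT with h0 | h0
  · rw [h0]
    rcases Nat.eq_zero_or_pos #IN with h1 | h1
    · rw [h1]
    · exact ((Finset.card_eq_zero.1 h0) ▸ hIO (Finset.card_pos.1 h1)).elim (fun _ h => by simp at h)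
  · have h1 : 0 < #IN := Finset.card_pos.2 (hOI (Finset.card_pos.1 h0))
    omega

open scoped Classical in
/-- No traversed edge enters a vertex of `B₁` (such a vertex is always rooted in `B₁`). [folklore] -/
theorem traversed_in_eq_empty {a : V} (ha : a ∈ B₁) :
    (Finset.univ.filter fun w => s(w, a) ∈ ω' ∧
        #(ω'.erase s(w, a)) + 2 * clusterCount (↑(ω'.erase s(w, a)) : BondConfig V) W = m ∧
        (∃ a' ∈ B₁, (openGraph (↑(ω'.erase s(w, a)) : BondConfig V)).Reachable w a') ∧
        ¬ ∃ a' ∈ B₁, (openGraph (↑(ω'.erase s(w, a)) : BondConfig V)).Reachable a a') = ∅ := by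
  refine Finset.filter_eq_empty_iff.2 fun w _ hw => ?_
  exact hw.2.2.2 ⟨a, ha, Reachable.refl _⟩

open scoped Classical in
/-- **Unit source strength**: in a crossing configuration of exponent `m + 1` exactly one
traversed edge leaves `B₁`. [folklore] -/
theorem sum_card_traversed_out_eq_one [DecidablePred (· ∈ B₁)]
    (hm : ∀ ω ⊆ G.edgeFinset, m ≤ #ω + 2 * clusterCount (↑ω : BondConfig V) W)
    (hω' : ω' ⊆ G.edgeFinset) (hE' : #ω' + 2 * clusterCount (↑ω' : BondConfig V) W = m + 1)
    (hB₁ : B₁ ⊆ W) (hB₂ : B₂ ⊆ W) (hW : W ⊆ B₁ ∪ B₂) (hdisj : Disjoint B₁ B₂)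
    (hcross : ∃ a ∈ B₁, ∃ b ∈ B₂, (openGraph (↑ω' : BondConfig V)).Reachable a b) :
    ∑ a, (if a ∈ B₁ then
      #(Finset.univ.filter fun w => s(a, w) ∈ ω' ∧
        #(ω'.erase s(a, w)) + 2 * clusterCount (↑(ω'.erase s(a, w)) : BondConfig V) W = m ∧
        (∃ a' ∈ B₁, (openGraph (↑(ω'.erase s(a, w)) : BondConfig V)).Reachable a a') ∧
        ¬ ∃ a' ∈ B₁, (openGraph (↑(ω'.erase s(a, w)) : BondConfig V)).Reachable w a') else 0) = 1 := by
  set OUT : V → Finset V := fun a => Finset.univ.filter fun w => s(a, w) ∈ ω' ∧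
        #(ω'.erase s(a, w)) + 2 * clusterCount (↑(ω'.erase s(a, w)) : BondConfig V) W = m ∧
        (∃ a' ∈ B₁, (openGraph (↑(ω'.erase s(a, w)) : BondConfig V)).Reachable a a') ∧
        ¬ ∃ a' ∈ B₁, (openGraph (↑(ω'.erase s(a, w)) : BondConfig V)).Reachable w a' with hOUT
  -- the source vertex
  obtain ⟨a₀, ha₀, w₀, h₀, hE₀, hn₀⟩ := exists_traversed_source hB₁ hB₂ hdisj hm hω' hE' hcross
  have hw₀ : w₀ ∈ OUT a₀ := by
    rw [hOUT, Finset.mem_filter]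
    exact ⟨Finset.mem_univ _, h₀, hE₀, ⟨a₀, ha₀, Reachable.refl _⟩, hn₀⟩
  -- every other vertex of `B₁` has no outgoing traversed edge
  have hother : ∀ a, a ∈ B₁ → a ≠ a₀ → OUT a = ∅ := by
    intro a ha hne
    refine Finset.filter_eq_empty_iff.2 fun w _ hw => hne ?_
    exact traversed_source_unique hm hω' hB₁ hB₂ hW hdisj ha ha₀ hw.1 hw.2.1 hw.2.2.2 h₀ hE₀ hn₀
  have hcard₀ : #(OUT a₀) = 1 := by
    refine le_antisymm (Finset.card_le_one.2 fun w₁ hw₁ w₂ hw₂ => ?_) (Finset.card_pos.2 ⟨w₀, hw₀⟩)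
    rw [hOUT, Finset.mem_filter] at hw₁ hw₂
    exact traversed_out_unique hm hω' hE' hB₁ hB₂ hW hdisj hcross hw₁.2.1 hw₁.2.2.1 hw₁.2.2.2.1
      hw₁.2.2.2.2 hw₂.2.1 hw₂.2.2.1 hw₂.2.2.2.1 hw₂.2.2.2.2
  rw [Finset.sum_eq_single a₀]
  · rw [if_pos ha₀]
    exact hcard₀
  · intro a _ hne
    by_cases ha : a ∈ B₁
    · rw [if_pos ha]
      change #(OUT a) = 0
      rw [hother a ha hne, Finset.card_empty]
    · rw [if_neg ha]
  · intro h
    exact (h (Finset.mem_univ _)).elim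

end Counting

end KirchhoffSlope

end Summit.CriticalPhenomena.CardyFormulaZ2.Theorems
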